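import Mathlib
import HarnessLib
import Summits.NavierStokesRegularity.NavierStokesRegularity.Theorems.UnthreadedRigidityDoorUnthreadedRigidityVirialHornOrderTwoStructure

/-!
# Route `UnthreadedRigidityDoor`, item `UnthreadedRigidity` (W2, stmt-NavierStokesRegularity-27585) — LINE g11-1 «VIRIAL HORN»:
# (F2) ORDER-TWO LAW, part 2 — BRACKET CALCULUS and the explicit shell against its vorticity

Bracket calculus for `{f,g} = pbr f g = det[y, ∇f, ∇g]` against a solid harmonic `Y`: radial factors pass through
(`pbr_radial_mul`), functions of `Y` drop out (`pbr_self_sq`, `pbr_self`), linearity (`pbr_add`, `pbr_sub`, `pbr_const_mul`),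
`⟪∇Y, ∇f × y⟫ = {Y, f}`; the explicit shell `P = a(|y|²)∇Y − (b(|y|²)Y) y` against its toroidal vorticity
`ω = −c(|y|²)(∇Y × y)`: `ω × P = f₁ y + f₂ ∇Y` with `f₁ = c(b l Y² − a|∇Y|²)`, `f₂ = cY(al − b|y|²)` (`cross_vorticity_shell`),
★ `⟪∇Y, curl(ω × P)⟫ = −c a {Y,|∇Y|²}` (`inner_gradient_curl_cross_vorticity_shell`), `⟪ω × P, y⟫`; toroidal fields do not see
`∇Y` (`inner_gradient_curl_curl_curl_eq_zero`), `⟪curl curl P, y⟫ = −l(l+1) c Y` (`inner_curl_curl_self_of_vorticity`); the Euler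
operator `y·∇` on the explicit shell and `y·∇(|P|²/2)` (`fderiv_explicitShell_apply_self`, `euler_half_norm_sq_explicitShell`).
These are the ingredients of the explicit ORDER-TWO LAW `c₂ = K(α²{Y,|∇Y|²} − {Y, y·∇p})` (half (A) `ThreadingJets.OrderTwoLawSlice`
of director-ns dss_146's split, assembled in part 3 `…VirialHornOrderTwoLaw`).

HONEST LABEL: explicit-field calculus (an L-part) on a RUNG line about SPECIAL separable data; `UnthreadedRigidity` (27585), W2 and
NS regularity remain OPEN.  `--supports stmt-NavierStokesRegularity-27585` (helper); ns-crc-p2 g8.  [cite: MajdaBertozziCUP2002, §1.1 (vector identities), §2.1]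
-/

-- the summit and its single sub-problem share the name (CONVENTIONS §1)
set_option linter.dupNamespace false

namespace Summit.NavierStokesRegularity.NavierStokesRegularity.Theorems.UnthreadedRigidity.VirialHorn

open scoped Topology Laplacian
open Filter Set Function
open Summit.NavierStokesRegularity.NavierStokesRegularity.Theorems.UnthreadedRigidity.ProfileHorn (E3)
open Literature.Analysis.FluidPDE

/-! ## §1 Bracket calculus `{Y, ·}` -/

/-- `det[y, v, c y] = 0`. [folklore] -/
theorem det3_smul_self_right (y v : E3) (c : ℝ) : det3 y v (c • y) = 0 := by
  simp only [det3, PiLp.smul_apply, smul_eq_mul]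
  ring

/-- `det[y, v, c v] = 0`. [folklore] -/
theorem det3_smul_self_mid (y v : E3) (c : ℝ) : det3 y v (c • v) = 0 := by
  simp only [det3, PiLp.smul_apply, smul_eq_mul]
  ring

/-- `det3` is additive and homogeneous in its last slot. [folklore] -/
theorem det3_add_right (y v w₁ w₂ : E3) : det3 y v (w₁ + w₂) = det3 y v w₁ + det3 y v w₂ := by
  simp only [det3, PiLp.add_apply]
  ring

/-- `det3` is homogeneous in its last slot. [folklore] -/
theorem det3_smul_right (y v w : E3) (c : ℝ) : det3 y v (c • w) = c * det3 y v w := by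
  simp only [det3, PiLp.smul_apply, smul_eq_mul]
  ring

/-- RADIAL FACTORS PASS THROUGH THE BRACKET: `{Y, ρ(|y|²) g} = ρ(|y|²) {Y, g}` (`∇ρ(|y|²) ∥ y`). [folklore] -/
theorem pbr_radial_mul {ρ : ℝ → ℝ} (hρ : Differentiable ℝ ρ) (Y : E3 → ℝ) {g : E3 → ℝ} {y : E3}
    (hg : DifferentiableAt ℝ g y) :
    pbr Y (fun z : E3 => ρ (‖z‖ ^ 2) * g z) y = ρ (‖y‖ ^ 2) * pbr Y g y := by
  have hR : DifferentiableAt ℝ (fun z : E3 => ρ (‖z‖ ^ 2)) y := differentiableAt_radial hρ y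
  have hgrad : gradient (fun z : E3 => ρ (‖z‖ ^ 2) * g z) y =
      ρ (‖y‖ ^ 2) • gradient g y + g y • gradient (fun z : E3 => ρ (‖z‖ ^ 2)) y := by
    rw [gradient, fderiv_fun_mul hR hg, map_add, map_smul, map_smul]
    rfl
  rw [pbr, hgrad, gradient_radial hρ, det3_add_right, det3_smul_right, smul_smul, det3_smul_self_right, add_zero, pbr]

/-- FUNCTIONS OF `Y` DROP OUT: `{Y, Y²} = 0`. [folklore] -/
theorem pbr_self_sq {l : ℕ} {Y : E3 → ℝ} (hY : IsSolidHarmonic l Y) (y : E3) :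
    pbr Y (fun z : E3 => Y z ^ 2) y = 0 := by
  have hYd : Differentiable ℝ Y := hY.contDiff.differentiable (by simp)
  have hgrad : gradient (fun z : E3 => Y z ^ 2) y = (2 * Y y) • gradient Y y := by
    rw [gradient, show (fun z : E3 => Y z ^ 2) = fun z => Y z * Y z from funext fun z => sq (Y z),
      fderiv_fun_mul (hYd y) (hYd y), map_add, map_smul]
    rw [gradient, two_mul, add_smul]
  rw [pbr, hgrad, det3_smul_self_mid]

/-- `{Y, Y} = 0`. [folklore] -/
theorem pbr_self (Y : E3 → ℝ) (y : E3) : pbr Y Y y = 0 := by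
  have : gradient Y y = (1 : ℝ) • gradient Y y := (one_smul _ _).symm
  rw [pbr]
  conv_lhs => rw [show det3 y (gradient Y y) (gradient Y y) = det3 y (gradient Y y) ((1 : ℝ) • gradient Y y) by
    rw [one_smul]]
  exact det3_smul_self_mid _ _ _

/-- linearity of the bracket in the second slot. [folklore] -/
theorem pbr_sub (Y : E3 → ℝ) {g₁ g₂ : E3 → ℝ} {y : E3} (h₁ : DifferentiableAt ℝ g₁ y) (h₂ : DifferentiableAt ℝ g₂ y) :
    pbr Y (fun z => g₁ z - g₂ z) y = pbr Y g₁ y - pbr Y g₂ y := by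
  have : gradient (fun z => g₁ z - g₂ z) y = gradient g₁ y - gradient g₂ y := by
    rw [gradient, fderiv_fun_sub h₁ h₂, map_sub]
    rfl
  rw [pbr, this, sub_eq_add_neg, ← neg_one_smul ℝ (gradient g₂ y), det3_add_right, det3_smul_right, pbr, pbr]
  ring

/-- linearity of the bracket in the second slot. [folklore] -/
theorem pbr_add (Y : E3 → ℝ) {g₁ g₂ : E3 → ℝ} {y : E3} (h₁ : DifferentiableAt ℝ g₁ y) (h₂ : DifferentiableAt ℝ g₂ y) :
    pbr Y (fun z => g₁ z + g₂ z) y = pbr Y g₁ y + pbr Y g₂ y := by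
  have : gradient (fun z => g₁ z + g₂ z) y = gradient g₁ y + gradient g₂ y := by
    rw [gradient, fderiv_fun_add h₁ h₂, map_add]
    rfl
  rw [pbr, this, det3_add_right, pbr, pbr]

/-- scalars pass through the bracket. [folklore] -/
theorem pbr_const_mul (Y : E3 → ℝ) (c : ℝ) {g : E3 → ℝ} {y : E3} (hg : DifferentiableAt ℝ g y) :
    pbr Y (fun z => c * g z) y = c * pbr Y g y := by
  have : gradient (fun z => c * g z) y = c • gradient g y := by
    rw [gradient, fderiv_const_mul hg, map_smul]
    rfl
  rw [pbr, this, det3_smul_right, pbr]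

/-- The scalar triple product read the other way: `⟪∇Y, ∇f × y⟫ = {Y, f}`. [folklore] -/
theorem inner_gradient_cross_gradient_self (Y f : E3 → ℝ) (y : E3) :
    inner ℝ (gradient Y y) (cross (gradient f y) y) = pbr Y f y := by
  rw [pbr, det3]
  simp only [cross, PiLp.inner_apply, RCLike.inner_apply, conj_trivial, Fin.sum_univ_three,
    cross_apply, Matrix.cons_val_zero, Matrix.cons_val_one, Matrix.cons_val_two,
    Matrix.head_cons, Matrix.tail_cons]
  ring

/-! ## §2 The shell against its vorticity -/

/-- BAC–CAB for the shell: `(∇Y × y) × ∇Y = |∇Y|² y − (lY) ∇Y` and `(∇Y × y) × y = (lY) y − |y|² ∇Y` give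
`(−c(∇Y × y)) × (a∇Y − (bY) y) = c(blY² − a|∇Y|²) y + cY(al − b|y|²) ∇Y`. [folklore] -/
theorem cross_vorticity_shell {l : ℕ} {Y : E3 → ℝ} (hY : IsSolidHarmonic l Y) (a b c : ℝ) (y : E3) :
    cross (-(c • cross (gradient Y y) y)) (a • gradient Y y - (b * Y y) • y) =
      (c * (b * (l : ℝ) * Y y ^ 2 - a * ‖gradient Y y‖ ^ 2)) • y
        + (c * Y y * (a * (l : ℝ) - b * ‖y‖ ^ 2)) • gradient Y y := by
  have hE : inner ℝ y (gradient Y y) = (l : ℝ) * Y y := hY.inner_self_gradient y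
  have h1 : cross (cross (gradient Y y) y) (gradient Y y) =
      ‖gradient Y y‖ ^ 2 • y - ((l : ℝ) * Y y) • gradient Y y := by
    rw [cross_swap (cross (gradient Y y) y), cross_cross_right, real_inner_comm y (gradient Y y), hE,
      real_inner_self_eq_norm_sq]
    module
  have h2 : cross (cross (gradient Y y) y) y = ((l : ℝ) * Y y) • y - ‖y‖ ^ 2 • gradient Y y := by
    rw [cross_swap (cross (gradient Y y) y) y, cross_cross_right, real_inner_self_eq_norm_sq, hE]
    module
  have hs₁ : ∀ (u v : E3) (r : ℝ), cross (r • u) v = r • cross u v := fun u v r => by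
    rw [← crossCLM_apply, map_smul]; rfl
  have hs₂ : ∀ (u v w : E3), cross u (v - w) = cross u v - cross u w := fun u v w => by
    rw [← crossCLM_apply, map_sub]; rfl
  have hs₃ : ∀ (u v : E3) (r : ℝ), cross u (r • v) = r • cross u v := fun u v r => by
    rw [← crossCLM_apply, map_smul]; rfl
  rw [← neg_smul, hs₁, hs₂, hs₃, hs₃, h1, h2]
  module

/-- THE CURL OF `f₁ y + f₂ ∇Y`: `curl (f₁•id + f₂•∇Y) = ∇f₁ × y + ∇f₂ × ∇Y` (`curl ∇Y = 0`). [folklore] -/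
theorem curl_smul_self_add_smul_gradient {l : ℕ} {Y : E3 → ℝ} (hY : IsSolidHarmonic l Y) {f₁ f₂ : E3 → ℝ} {y : E3}
    (h₁ : DifferentiableAt ℝ f₁ y) (h₂ : DifferentiableAt ℝ f₂ y) :
    curl (fun z : E3 => f₁ z • z + f₂ z • gradient Y z) y =
      cross (gradient f₁ y) y + cross (gradient f₂ y) (gradient Y y) := by
  have hgd : DifferentiableAt ℝ (gradient Y) y := (hY.contDiff_gradient.differentiable (by simp)) y
  have hC2 : ContDiff ℝ 2 Y := hY.contDiff.of_le (by norm_cast)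
  have hcurl_grad : curl (gradient Y) y = 0 := curl_gradient_eq_zero_holds Y hC2 y
  have hd1 : DifferentiableAt ℝ (fun z : E3 => f₁ z • z) y := h₁.smul differentiableAt_id
  have hd2 : DifferentiableAt ℝ (fun z : E3 => f₂ z • gradient Y z) y := h₂.smul hgd
  rw [curl_add hd1 hd2, curl_smul_self h₁, curl_smul h₂ hgd, hcurl_grad, smul_zero, zero_add, curlCLM_smulRight]
  rfl

/-- ★ `⟪∇Y, curl(ω × P)⟫ = −c a {Y, |∇Y|²}` for the explicit shell `P = a∇Y − (bY)y` with vorticity `ω = −c(∇Y × y)`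
(pointwise in `y`, with `a b c` the radial profiles evaluated through `|z|²`): `ω × P = f₁ z + f₂ ∇Y`,
`curl = ∇f₁ × y + ∇f₂ × ∇Y`, `⟪∇Y, ∇f₂ × ∇Y⟫ = 0`, `⟪∇Y, ∇f₁ × y⟫ = {Y, f₁}`, and in
`f₁ = c(|z|²)(b(|z|²) l Y² − a(|z|²)|∇Y|²)` the radial factors pass through the bracket and `{Y, Y²} = 0`. [folklore] -/
theorem inner_gradient_curl_cross_vorticity_shell {l : ℕ} {Y : E3 → ℝ} (hY : IsSolidHarmonic l Y) {a b c : ℝ → ℝ}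
    (ha : Differentiable ℝ a) (hb : Differentiable ℝ b) (hc : Differentiable ℝ c) (y : E3) :
    inner ℝ (gradient Y y) (curl (fun z : E3 => cross (-(c (‖z‖ ^ 2) • cross (gradient Y z) z))
        (a (‖z‖ ^ 2) • gradient Y z - (b (‖z‖ ^ 2) * Y z) • z)) y) =
      -(c (‖y‖ ^ 2) * a (‖y‖ ^ 2) * angForm Y y) := by
  have hYd : Differentiable ℝ Y := hY.contDiff.differentiable (by simp)
  have hGn : Differentiable ℝ (fun z : E3 => ‖gradient Y z‖ ^ 2) :=
    (hY.contDiff_gradient.differentiable (by simp)).norm_sq ℝ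
  -- the field, rewritten through `cross_vorticity_shell`
  have hfield : (fun z : E3 => cross (-(c (‖z‖ ^ 2) • cross (gradient Y z) z))
        (a (‖z‖ ^ 2) • gradient Y z - (b (‖z‖ ^ 2) * Y z) • z)) =
      fun z : E3 => (c (‖z‖ ^ 2) * (b (‖z‖ ^ 2) * (l : ℝ) * Y z ^ 2 - a (‖z‖ ^ 2) * ‖gradient Y z‖ ^ 2)) • z
        + (c (‖z‖ ^ 2) * Y z * (a (‖z‖ ^ 2) * (l : ℝ) - b (‖z‖ ^ 2) * ‖z‖ ^ 2)) • gradient Y z :=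
    funext fun z => cross_vorticity_shell hY _ _ _ z
  -- differentiability of the two coefficients
  have hA : ∀ z : E3, DifferentiableAt ℝ (fun z : E3 => a (‖z‖ ^ 2)) z := differentiableAt_radial ha
  have hB : ∀ z : E3, DifferentiableAt ℝ (fun z : E3 => b (‖z‖ ^ 2)) z := differentiableAt_radial hb
  have hC : ∀ z : E3, DifferentiableAt ℝ (fun z : E3 => c (‖z‖ ^ 2)) z := differentiableAt_radial hc
  have hN : ∀ z : E3, DifferentiableAt ℝ (fun z : E3 => ‖z‖ ^ 2) z := fun z =>
    ((contDiff_norm_sq ℝ (n := 1)).differentiable one_ne_zero).differentiableAt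
  have hin : DifferentiableAt ℝ (fun z : E3 => b (‖z‖ ^ 2) * (l : ℝ) * Y z ^ 2 - a (‖z‖ ^ 2) * ‖gradient Y z‖ ^ 2) y :=
    (((hB y).mul_const _).mul ((hYd y).pow 2)).sub ((hA y).mul (hGn y))
  have h₁ : DifferentiableAt ℝ
      (fun z : E3 => c (‖z‖ ^ 2) * (b (‖z‖ ^ 2) * (l : ℝ) * Y z ^ 2 - a (‖z‖ ^ 2) * ‖gradient Y z‖ ^ 2)) y :=
    (hC y).mul hin
  have h₂ : DifferentiableAt ℝ
      (fun z : E3 => c (‖z‖ ^ 2) * Y z * (a (‖z‖ ^ 2) * (l : ℝ) - b (‖z‖ ^ 2) * ‖z‖ ^ 2)) y :=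
    ((hC y).mul (hYd y)).mul (((hA y).mul_const _).sub ((hB y).mul (hN y)))
  rw [hfield, curl_smul_self_add_smul_gradient hY h₁ h₂, inner_add_right, real_inner_comm (cross _ (gradient Y y)) (gradient Y y),
    inner_cross_self_right, add_zero, inner_gradient_cross_gradient_self]
  -- evaluate the bracket `{Y, f₁}`
  rw [pbr_radial_mul hc Y hin]
  have hs1 : DifferentiableAt ℝ (fun z : E3 => b (‖z‖ ^ 2) * (l : ℝ) * Y z ^ 2) y := ((hB y).mul_const _).mul ((hYd y).pow 2)
  have hs2 : DifferentiableAt ℝ (fun z : E3 => a (‖z‖ ^ 2) * ‖gradient Y z‖ ^ 2) y := (hA y).mul (hGn y)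
  rw [pbr_sub Y hs1 hs2, pbr_radial_mul ha Y (hGn y)]
  have e1 : (fun z : E3 => b (‖z‖ ^ 2) * (l : ℝ) * Y z ^ 2) = fun z : E3 => b (‖z‖ ^ 2) * ((l : ℝ) * Y z ^ 2) :=
    funext fun z => mul_assoc _ _ _
  have hY2 : DifferentiableAt ℝ (fun z : E3 => Y z ^ 2) y := (hYd y).pow 2
  have hlY2 : DifferentiableAt ℝ (fun z : E3 => (l : ℝ) * Y z ^ 2) y := hY2.const_mul _
  rw [e1, pbr_radial_mul hb Y hlY2, pbr_const_mul Y _ hY2, pbr_self_sq hY, angForm]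
  ring

/-- `⟪ω × P, y⟫ = f₁|y|² + f₂ lY` for the explicit shell and its vorticity. [folklore] -/
theorem inner_cross_vorticity_shell_self {l : ℕ} {Y : E3 → ℝ} (hY : IsSolidHarmonic l Y) (a b c : ℝ) (y : E3) :
    inner ℝ (cross (-(c • cross (gradient Y y) y)) (a • gradient Y y - (b * Y y) • y)) y =
      c * (b * (l : ℝ) * Y y ^ 2 - a * ‖gradient Y y‖ ^ 2) * ‖y‖ ^ 2
        + c * Y y * (a * (l : ℝ) - b * ‖y‖ ^ 2) * ((l : ℝ) * Y y) := by
  rw [cross_vorticity_shell hY, inner_add_left, real_inner_smul_left, real_inner_smul_left, real_inner_self_eq_norm_sq,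
    real_inner_comm y (gradient Y y), hY.inner_self_gradient]

/-! ## §3 Toroidal fields do not see `∇Y`; the radial read-off of `curl curl P` -/

/-- If `curl P = −c(|y|²)(∇Y × y)` with a smooth `c`, then `curl curl curl P` is again toroidal, so `⟪∇Y, curl curl curl P⟫ = 0`
(`curl P = −curl((cY)y)` by `curl_shell_eq`, and `exists_curl_curl_curl_shell`). [folklore] -/
theorem inner_gradient_curl_curl_curl_eq_zero {l : ℕ} {Y : E3 → ℝ} (hY : IsSolidHarmonic l Y) {c : ℝ → ℝ}
    (hc : ContDiff ℝ (⊤ : ℕ∞) c) {P : E3 → E3}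
    (hω : curl P = fun y : E3 => -(c (‖y‖ ^ 2) • cross (gradient Y y) y)) (y : E3) :
    inner ℝ (gradient Y y) (curl (curl (curl P)) y) = 0 := by
  have hcd : Differentiable ℝ c := hc.differentiable (by simp)
  have hYd : Differentiable ℝ Y := hY.contDiff.differentiable (by simp)
  have e1 : curl P = fun z : E3 => -curl (fun w : E3 => (c (‖w‖ ^ 2) * Y w) • w) z := by
    rw [hω, curl_shell_eq hcd hYd]
  have e2 : curl (curl P) = fun z : E3 => -curl (curl (fun w : E3 => (c (‖w‖ ^ 2) * Y w) • w)) z := by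
    funext z
    rw [e1, curl_neg]
  obtain ⟨c', -, hc'⟩ := exists_curl_curl_curl_shell hc hY
  rw [e2, curl_neg, hc', inner_neg_right, inner_neg_right, neg_neg, real_inner_smul_right,
    real_inner_comm (cross _ _) (gradient Y y), inner_cross_self_left, mul_zero]

/-- If `curl P = −c(|y|²)(∇Y × y)` with `c ∈ C¹`, then `⟪curl curl P (y), y⟫ = −l(l+1) c(|y|²) Y(y)`
(`curl P = −curl((cY)y)` and `inner_curl_curl_shell_self`). [folklore] -/
theorem inner_curl_curl_self_of_vorticity {l : ℕ} {Y : E3 → ℝ} (hY : IsSolidHarmonic l Y) (hl : 1 ≤ l) {c : ℝ → ℝ}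
    (hc : ContDiff ℝ 1 c) {P : E3 → E3}
    (hω : curl P = fun y : E3 => -(c (‖y‖ ^ 2) • cross (gradient Y y) y)) (y : E3) :
    inner ℝ (curl (curl P) y) y = -(((l : ℝ) * ((l : ℝ) + 1)) * (c (‖y‖ ^ 2) * Y y)) := by
  have hcd : Differentiable ℝ c := hc.differentiable (by simp)
  have hYd : Differentiable ℝ Y := hY.contDiff.differentiable (by simp)
  have e1 : curl P = fun z : E3 => -curl (fun w : E3 => (c (‖w‖ ^ 2) * Y w) • w) z := by
    rw [hω, curl_shell_eq hcd hYd]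
  rw [e1, curl_neg, inner_neg_left, inner_curl_curl_shell_self hc hY hl]

/-! ## §4 The Euler operator `y·∇` on the explicit shell and `y·∇(|P|²/2)` -/

/-- `D(ρ(|·|²))(y)·y = 2|y|² ρ′(|y|²)`. [folklore] -/
theorem fderiv_radial_apply_self {ρ : ℝ → ℝ} (hρ : Differentiable ℝ ρ) (y : E3) :
    fderiv ℝ (fun z : E3 => ρ (‖z‖ ^ 2)) y y = 2 * ‖y‖ ^ 2 * deriv ρ (‖y‖ ^ 2) := by
  rw [← inner_gradient_left, gradient_radial hρ, real_inner_smul_left, real_inner_self_eq_norm_sq]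
  ring

/-- EULER ALONG `y` FOR THE EXPLICIT SHELL: `DP(y)·y = (2|y|²a′ + (l−1)a) ∇Y − ((2|y|²b′ + (l+1)b) Y) y`. [folklore] -/
theorem fderiv_explicitShell_apply_self {l : ℕ} {Y : E3 → ℝ} (hY : IsSolidHarmonic l Y) {a b : ℝ → ℝ}
    (ha : Differentiable ℝ a) (hb : Differentiable ℝ b) (y : E3) :
    fderiv ℝ (fun z : E3 => a (‖z‖ ^ 2) • gradient Y z - (b (‖z‖ ^ 2) * Y z) • z) y y =
      (2 * ‖y‖ ^ 2 * deriv a (‖y‖ ^ 2) + ((l : ℝ) - 1) * a (‖y‖ ^ 2)) • gradient Y y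
        - ((2 * ‖y‖ ^ 2 * deriv b (‖y‖ ^ 2) + ((l : ℝ) + 1) * b (‖y‖ ^ 2)) * Y y) • y := by
  have hYd : Differentiable ℝ Y := hY.contDiff.differentiable (by simp)
  have hgd : DifferentiableAt ℝ (gradient Y) y := (hY.contDiff_gradient.differentiable (by simp)) y
  have hA : DifferentiableAt ℝ (fun z : E3 => a (‖z‖ ^ 2)) y := differentiableAt_radial ha y
  have hB : DifferentiableAt ℝ (fun z : E3 => b (‖z‖ ^ 2)) y := differentiableAt_radial hb y
  have hBY : DifferentiableAt ℝ (fun z : E3 => b (‖z‖ ^ 2) * Y z) y := hB.mul (hYd y)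
  have h1 : DifferentiableAt ℝ (fun z : E3 => a (‖z‖ ^ 2) • gradient Y z) y := hA.smul hgd
  have h2 : DifferentiableAt ℝ (fun z : E3 => (b (‖z‖ ^ 2) * Y z) • z) y := hBY.smul differentiableAt_id
  have h2' : HasFDerivAt (fun z : E3 => (b (‖z‖ ^ 2) * Y z) • z)
      ((b (‖y‖ ^ 2) * Y y) • ContinuousLinearMap.id ℝ E3
        + (fderiv ℝ (fun z : E3 => b (‖z‖ ^ 2) * Y z) y).smulRight y) y :=
    hBY.hasFDerivAt.smul (hasFDerivAt_id y)
  rw [fderiv_fun_sub h1 h2, fderiv_fun_smul hA hgd, h2'.fderiv, fderiv_fun_mul hB (hYd y)]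
  simp only [sub_apply, add_apply, smul_apply, ContinuousLinearMap.smulRight_apply, ContinuousLinearMap.coe_id', id]
  rw [hY.hessian_apply_self, fderiv_radial_apply_self ha, fderiv_radial_apply_self hb, hY.fderiv_apply_self]
  module

/-- `y·∇(|P|²/2) = ⟪P, DP·y⟫ = (2|y|²aa′ + (l−1)a²)|∇Y|² + R(|y|²) Y²` for the explicit shell, with the explicit radial `R`. [folklore] -/
theorem euler_half_norm_sq_explicitShell {l : ℕ} {Y : E3 → ℝ} (hY : IsSolidHarmonic l Y) {a b : ℝ → ℝ}
    (ha : Differentiable ℝ a) (hb : Differentiable ℝ b) (y : E3) :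
    inner ℝ (gradient (fun w : E3 => ‖a (‖w‖ ^ 2) • gradient Y w - (b (‖w‖ ^ 2) * Y w) • w‖ ^ 2 / 2) y) y =
      (2 * ‖y‖ ^ 2 * a (‖y‖ ^ 2) * deriv a (‖y‖ ^ 2) + ((l : ℝ) - 1) * a (‖y‖ ^ 2) ^ 2) * ‖gradient Y y‖ ^ 2
        + (b (‖y‖ ^ 2) * ‖y‖ ^ 2 * (2 * ‖y‖ ^ 2 * deriv b (‖y‖ ^ 2) + ((l : ℝ) + 1) * b (‖y‖ ^ 2))
            - a (‖y‖ ^ 2) * (l : ℝ) * (2 * ‖y‖ ^ 2 * deriv b (‖y‖ ^ 2) + ((l : ℝ) + 1) * b (‖y‖ ^ 2))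
            - b (‖y‖ ^ 2) * (l : ℝ) * (2 * ‖y‖ ^ 2 * deriv a (‖y‖ ^ 2) + ((l : ℝ) - 1) * a (‖y‖ ^ 2))) * Y y ^ 2 := by
  have hYd : Differentiable ℝ Y := hY.contDiff.differentiable (by simp)
  have hgd : DifferentiableAt ℝ (gradient Y) y := (hY.contDiff_gradient.differentiable (by simp)) y
  have hA : DifferentiableAt ℝ (fun z : E3 => a (‖z‖ ^ 2)) y := differentiableAt_radial ha y
  have hB : DifferentiableAt ℝ (fun z : E3 => b (‖z‖ ^ 2)) y := differentiableAt_radial hb y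
  have hPd : DifferentiableAt ℝ (fun z : E3 => a (‖z‖ ^ 2) • gradient Y z - (b (‖z‖ ^ 2) * Y z) • z) y :=
    (hA.smul hgd).sub ((hB.mul (hYd y)).smul differentiableAt_id)
  rw [inner_gradient_left, (hasFDerivAt_half_norm_sq hPd).fderiv, ContinuousLinearMap.comp_apply, innerSL_apply_apply,
    fderiv_explicitShell_apply_self hY ha hb, inner_sub_left, inner_sub_right, inner_sub_right, real_inner_smul_left,
    real_inner_smul_left, real_inner_smul_left, real_inner_smul_left, real_inner_smul_right, real_inner_smul_right,
    real_inner_smul_right, real_inner_smul_right, real_inner_self_eq_norm_sq, real_inner_self_eq_norm_sq,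
    real_inner_comm y (gradient Y y), hY.inner_self_gradient]
  ring

end Summit.NavierStokesRegularity.NavierStokesRegularity.Theorems.UnthreadedRigidity.VirialHorn
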